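import Summits.ResolutionOfSingularities.ResolutionOfSingularities.Theorems.FrobeniusLadderFInjectiveMacaulayficationWeightCoactionZ
import Summits.ResolutionOfSingularities.ResolutionOfSingularities.Theorems.FrobeniusLadderFInjectiveMacaulayficationRingVeroneseAway
import Summits.ResolutionOfSingularities.ResolutionOfSingularities.Theorems.FrobeniusLadderFInjectiveMacaulayficationFilteredReesCarrier
import HarnessLib

/-!
# (F1)+(F3) on the filtered Rees carrier: the Rees–Veronese interface of `T′♮` (crux `FInjectiveMacaulayfication`, §17 G4♮)

Support file for crux stmt-ResolutionOfSingularities-15315 (`FrobeniusLadder.FInjectiveMacaulayfication`,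
filtered engine §17 / G4♮, CRUX-PLAN w45a v5 §1.3 pieces (F1) and (F3), owner stub-4). [OURS · L1 W4.5a] — AI-written,
weaker than expert review; not a statement of any manuscript.

Carrier (F0) of res-L1-w45a-stub-3 (`…FilteredReesCarrier`): `A = k[X_σ]`, `σ = Option (Fin n)`, `s = X none`,
weights `o ↦ o.elim (-1) (w ·)`, `f^h` with `hfh`/`hD0`, `ℛ = A/(f^h)`, `u = x̄_{some v}^c`, `T′♮ = ℛ[1/u]`.

* `adjoin_X_invSelf` — `(k[X_σ]/(g))[1/u]` is generated over `k` by the classes of the variables and `1/u` (any `σ`);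
* `filteredReesInterface` — (F1)+(F3): for ANY ring map `λ : T′♮ → T′♮[T;T⁻¹]` satisfying the characterising identity
  `λ (ā/1) = a(x̄_o T^{deg o})` (it exists: `WeightCoactionZ.exists_weightCoactionZ`; it is unique), the degree-`0`
  subalgebra `T₀` of `λ` (given with its membership characterisation) and a ring isomorphism `ι : C ≃+* T₀` with
  `ι u₀ = (u/1)·(s/1)^N` ((F2), lead-1), the bundle of `GradedChartClauseAssembly.chartClause_core_affine` in
  continuation-passing form: the `N`-Veronese subalgebra `A′ ⊆ T′♮` with `T′♮` integral over it and an `A′`-linear retraction,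
  `(s/1)^N ∈ A′`, a ring `T` (bound with its `CommRing` instance) with `ι′ : C ≃+* T`, `e : T[Y][1/Y] ≃+* A′`, and
  `e⁻¹((s/1)^N) ∈ (ι′ u₀)` — by `RingVeroneseAway.reesInterfaceRing`.

Folklore; no definitions, no named facts.
-/

-- single-problem summit: the doubled namespace component is forced
set_option linter.dupNamespace false

noncomputable section

open scoped LaurentPolynomial Polynomial
open AddMonoidAlgebra LaurentPolynomial
open Summit.ResolutionOfSingularities.ResolutionOfSingularities.Theorems.FInjectiveMacaulayfication
open Summit.ResolutionOfSingularities.ResolutionOfSingularities.Theorems.FInjectiveMacaulayfication.LaurentCoaction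

namespace Summit.ResolutionOfSingularities.ResolutionOfSingularities.Theorems.FInjectiveMacaulayfication.FilteredReesInterface

variable {k : Type} [Field k] {σ : Type}

/-- `(k[X_σ]/(g))[1/u]` is generated over `k` by the classes of the variables and `1/u`. [folklore] -/
theorem adjoin_X_invSelf (g : MvPolynomial σ k) (u : MvPolynomial σ k ⧸ Ideal.span {g}) :
    Algebra.adjoin k (Set.range (fun j : σ => algebraMap (MvPolynomial σ k ⧸ Ideal.span {g})
        (Localization.Away u) (Ideal.Quotient.mk (Ideal.span {g}) (MvPolynomial.X j))) ∪
      {IsLocalization.Away.invSelf (S := Localization.Away u) u}) = ⊤ := by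
  set G := Set.range (fun j : σ => algebraMap (MvPolynomial σ k ⧸ Ideal.span {g})
        (Localization.Away u) (Ideal.Quotient.mk (Ideal.span {g}) (MvPolynomial.X j))) ∪
      {IsLocalization.Away.invSelf (S := Localization.Away u) u} with hG
  have hR : ∀ a : MvPolynomial σ k, algebraMap (MvPolynomial σ k ⧸ Ideal.span {g})
      (Localization.Away u) (Ideal.Quotient.mk (Ideal.span {g}) a) ∈ Algebra.adjoin k G := by
    intro a
    have h1 : algebraMap (MvPolynomial σ k ⧸ Ideal.span {g}) (Localization.Away u)
        (Ideal.Quotient.mk (Ideal.span {g}) a) =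
        MvPolynomial.aeval (fun j : σ => algebraMap (MvPolynomial σ k ⧸ Ideal.span {g})
          (Localization.Away u) (Ideal.Quotient.mk (Ideal.span {g}) (MvPolynomial.X j))) a := by
      have h := MvPolynomial.aeval_unique ((IsScalarTower.toAlgHom k (MvPolynomial σ k ⧸ Ideal.span {g})
        (Localization.Away u)).comp (Ideal.Quotient.mkₐ k (Ideal.span {g})))
      exact (AlgHom.congr_fun h a :)
    rw [h1]
    have h2 : MvPolynomial.aeval (fun j : σ => algebraMap (MvPolynomial σ k ⧸ Ideal.span {g})
          (Localization.Away u) (Ideal.Quotient.mk (Ideal.span {g}) (MvPolynomial.X j))) a ∈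
        Algebra.adjoin k (Set.range (fun j : σ => algebraMap (MvPolynomial σ k ⧸ Ideal.span {g})
          (Localization.Away u) (Ideal.Quotient.mk (Ideal.span {g}) (MvPolynomial.X j)))) := by
      rw [Algebra.adjoin_range_eq_range_aeval]
      exact ⟨a, rfl⟩
    exact Algebra.adjoin_mono Set.subset_union_left h2
  have hinv : IsLocalization.Away.invSelf (S := Localization.Away u) u ∈ Algebra.adjoin k G :=
    Algebra.subset_adjoin (Set.mem_union_right _ rfl)
  refine eq_top_iff.mpr fun z _ => ?_
  obtain ⟨⟨r, s⟩, hz⟩ := IsLocalization.mk'_surjective (Submonoid.powers u) z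
  obtain ⟨j, hj⟩ := (Submonoid.mem_powers_iff _ _).mp s.2
  obtain ⟨a, rfl⟩ := Ideal.Quotient.mk_surjective r
  have hz' : z = algebraMap _ (Localization.Away u) (Ideal.Quotient.mk (Ideal.span {g}) a) *
      IsLocalization.Away.invSelf (S := Localization.Away u) u ^ j := by
    rw [← hz]
    refine (IsLocalization.mk'_eq_iff_eq_mul.mpr ?_)
    rw [mul_assoc, ← hj, map_pow, ← mul_pow, mul_comm (IsLocalization.Away.invSelf u), IsLocalization.Away.mul_invSelf,
      one_pow, mul_one]
  rw [hz']
  exact Subalgebra.mul_mem _ (hR a) (Subalgebra.pow_mem _ hinv j)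

/-- **(F1)+(F3): THE REES–VERONESE INTERFACE OF THE FILTERED CARRIER `T′♮`** (see the module docstring; `λ` is ANY ring
map satisfying the characterising coaction identity, `T₀` its degree-`0` subalgebra, `ι : C ≃+* T₀` with
`ι u₀ = (u/1)·(s/1)^N` the input of (F2)). Output: the hypothesis bundle of `chartClause_core_affine` with `b := s/1`,
in continuation-passing form. [folklore] -/
theorem filteredReesInterface (n : ℕ) (w : Fin n → ℕ) (v : Fin n) (hw : 0 < w v) (N c D : ℕ) (hcN : c * w v = N)
    (hc : 0 < c) (f : MvPolynomial (Fin n) k) (fh : MvPolynomial (Option (Fin n)) k)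
    (hfh : fh = ∑ b ∈ f.support, MvPolynomial.monomial
      (Finsupp.mapDomain some b + Finsupp.single none (Finsupp.weight w b - D)) (MvPolynomial.coeff b f))
    (hD0 : ∀ m < D, MvPolynomial.weightedHomogeneousComponent w m f = 0)
    (lam : Localization.Away (Ideal.Quotient.mk (Ideal.span {fh}) (MvPolynomial.X (some v)) ^ c) →+*
      (Localization.Away (Ideal.Quotient.mk (Ideal.span {fh}) (MvPolynomial.X (some v)) ^ c))[T;T⁻¹])
    (hlam : ∀ a : MvPolynomial (Option (Fin n)) k,
      lam (algebraMap (MvPolynomial (Option (Fin n)) k ⧸ Ideal.span {fh}) _ (Ideal.Quotient.mk (Ideal.span {fh}) a)) =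
        MvPolynomial.aeval (fun o : Option (Fin n) => single (o.elim (-1 : ℤ) (fun j => (w j : ℤ)))
          (algebraMap (MvPolynomial (Option (Fin n)) k ⧸ Ideal.span {fh})
            (Localization.Away (Ideal.Quotient.mk (Ideal.span {fh}) (MvPolynomial.X (some v)) ^ c))
            (Ideal.Quotient.mk (Ideal.span {fh}) (MvPolynomial.X o)))) a)
    (T₀ : Subalgebra k (Localization.Away (Ideal.Quotient.mk (Ideal.span {fh}) (MvPolynomial.X (some v)) ^ c)))
    (hT₀ : ∀ b, b ∈ T₀ ↔ lam b = single 0 b)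
    {C : Type} [CommRing C] (ι : C ≃+* T₀) (u₀ : C)
    (hιu : ((ι u₀ : T₀) : Localization.Away (Ideal.Quotient.mk (Ideal.span {fh}) (MvPolynomial.X (some v)) ^ c)) =
      algebraMap _ _ (Ideal.Quotient.mk (Ideal.span {fh}) (MvPolynomial.X (some v)) ^ c) *
        algebraMap _ _ (Ideal.Quotient.mk (Ideal.span {fh}) (MvPolynomial.X none)) ^ N)
    (P : Prop)
    (hP : ∀ (A' : Subalgebra k (Localization.Away (Ideal.Quotient.mk (Ideal.span {fh}) (MvPolynomial.X (some v)) ^ c)))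
      [Algebra.IsIntegral A' (Localization.Away (Ideal.Quotient.mk (Ideal.span {fh}) (MvPolynomial.X (some v)) ^ c))]
      (ρ : Localization.Away (Ideal.Quotient.mk (Ideal.span {fh}) (MvPolynomial.X (some v)) ^ c) →ₗ[A'] A'),
      (∀ x : A', ρ (x : Localization.Away (Ideal.Quotient.mk (Ideal.span {fh}) (MvPolynomial.X (some v)) ^ c)) = x) →
      ∀ (hsN : algebraMap _ (Localization.Away (Ideal.Quotient.mk (Ideal.span {fh}) (MvPolynomial.X (some v)) ^ c))
        (Ideal.Quotient.mk (Ideal.span {fh}) (MvPolynomial.X none)) ^ N ∈ A')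
      (T : Type) [CommRing T] (ι' : C ≃+* T) (e : Localization.Away (Polynomial.X : Polynomial T) ≃+* A'),
      e.symm ⟨_, hsN⟩ ∈ Ideal.span {algebraMap (Polynomial T)
        (Localization.Away (Polynomial.X : Polynomial T)) (Polynomial.C (ι' u₀))} → P) : P := by
  classical
  have hN : 0 < N := by rw [← hcN]; exact Nat.mul_pos hc hw
  -- the carrier is `(w,-1)`-homogeneous of weight `D`; `u` is the class of `X_{some v}^c`, of weight `N`
  have hfhom := FilteredReesCarrier.fh_isWeightedHomogeneous w D f fh hfh hD0
  have hUhom : MvPolynomial.IsWeightedHomogeneous (fun o : Option (Fin n) => o.elim (-1 : ℤ) (fun j => (w j : ℤ)))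
      (MvPolynomial.X (some v) ^ c : MvPolynomial (Option (Fin n)) k) (N : ℤ) := by
    have h := (MvPolynomial.isWeightedHomogeneous_X k (fun o : Option (Fin n) => o.elim (-1 : ℤ) (fun j => (w j : ℤ)))
      (some v)).pow c
    have hcw : c • (Option.elim (some v) (-1 : ℤ) fun j => (w j : ℤ)) = (N : ℤ) := by
      rw [Option.elim_some, nsmul_eq_mul, ← hcN, Nat.cast_mul]
    rwa [hcw] at h
  have hu : Ideal.Quotient.mk (Ideal.span {fh}) (MvPolynomial.X (some v) ^ c) =
      Ideal.Quotient.mk (Ideal.span {fh}) (MvPolynomial.X (some v)) ^ c := map_pow _ _ _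
  -- the coaction and the identification `lam = β`
  obtain ⟨β, hX, hk, hhom, hε, hΔ⟩ := WeightCoactionZ.exists_weightCoactionZ
    (fun o : Option (Fin n) => o.elim (-1 : ℤ) (fun j => (w j : ℤ))) fh D hfhom _ N hUhom _ hu
  have hlamβ : lam = β := by
    refine WeightCoactionZ.ringHom_ext_away fh _ _ lam β (fun c' => ?_) ?_
    · have h1 : algebraMap k (Localization.Away (Ideal.Quotient.mk (Ideal.span {fh}) (MvPolynomial.X (some v)) ^ c)) c' =
          algebraMap _ _ (Ideal.Quotient.mk (Ideal.span {fh}) (MvPolynomial.C c')) := by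
        rw [IsScalarTower.algebraMap_apply k (MvPolynomial (Option (Fin n)) k ⧸ Ideal.span {fh})]
        rfl
      rw [hk, h1, hlam, MvPolynomial.aeval_C, LaurentPolynomial.algebraMap_apply, ← h1]
    · rintro _ ⟨o, rfl⟩
      rw [hX, hlam, MvPolynomial.aeval_X]
  subst hlamβ
  -- the remaining inputs of the ring-level package
  have hU : lam (algebraMap _ (Localization.Away (Ideal.Quotient.mk (Ideal.span {fh}) (MvPolynomial.X (some v)) ^ c))
      (Ideal.Quotient.mk (Ideal.span {fh}) (MvPolynomial.X (some v)) ^ c)) =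
      single (N : ℤ) (algebraMap _ _ (Ideal.Quotient.mk (Ideal.span {fh}) (MvPolynomial.X (some v)) ^ c)) := by
    have h := hhom _ _ hUhom
    rw [hu] at h
    exact h
  have hUV := IsLocalization.Away.mul_invSelf (S := Localization.Away (Ideal.Quotient.mk (Ideal.span {fh})
    (MvPolynomial.X (some v)) ^ c)) (Ideal.Quotient.mk (Ideal.span {fh}) (MvPolynomial.X (some v)) ^ c)
  have hV := hom_of_mul_eq_one hUV hU
  have hb₀ : lam (algebraMap _ (Localization.Away (Ideal.Quotient.mk (Ideal.span {fh}) (MvPolynomial.X (some v)) ^ c))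
      (Ideal.Quotient.mk (Ideal.span {fh}) (MvPolynomial.X none))) =
      single (-1 : ℤ) (algebraMap _ _ (Ideal.Quotient.mk (Ideal.span {fh}) (MvPolynomial.X none))) := hX none
  have hG : ∀ g ∈ Set.range (fun o : Option (Fin n) => algebraMap (MvPolynomial (Option (Fin n)) k ⧸ Ideal.span {fh})
        (Localization.Away (Ideal.Quotient.mk (Ideal.span {fh}) (MvPolynomial.X (some v)) ^ c))
        (Ideal.Quotient.mk (Ideal.span {fh}) (MvPolynomial.X o))) ∪
      {IsLocalization.Away.invSelf (S := Localization.Away (Ideal.Quotient.mk (Ideal.span {fh})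
        (MvPolynomial.X (some v)) ^ c)) (Ideal.Quotient.mk (Ideal.span {fh}) (MvPolynomial.X (some v)) ^ c)},
      ∃ d : ℤ, lam g = single d g := by
    rintro g (⟨o, rfl⟩ | rfl)
    · exact ⟨_, hX o⟩
    · exact ⟨_, hV⟩
  exact RingVeroneseAway.reesInterfaceRing lam hε hΔ N hk hN _ _ hUV hU _ hG (adjoin_X_invSelf fh _) _ hb₀ T₀ hT₀ ι u₀
    hιu P hP

end Summit.ResolutionOfSingularities.ResolutionOfSingularities.Theorems.FInjectiveMacaulayfication.FilteredReesInterface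

end
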